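import Summits.PneNP.GCT.Max.KYAllMArithmetic
import Summits.PneNP.GCT.Max.KYSharperHighK
import Summits.PneNP.GCT.Max.KYSharperLowK
import Summits.PneNP.GCT.Max.KYPaddedPermanentSide
import Summits.PneNP.GCT.Max.KYRowMass
import Summits.PneNP.GCT.Max.DetKYLeadingTerms
import HarnessLib
import HarnessLib.Audit

/-!
# `GCT/Max`: the sharper all-`m` Koszul–Young ceiling — N-F-1 for every `m ≥ 5` from `n = ⌈3m/2⌉ + 1` on (W1′, PROVED)

Cell `pub-gct-max` (HOME `run/shared/lean/pub/pub-gct-max/`), track F, theory-2 gen 25 (skeleton) / gen 26 (arithmetic): the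
successor W1′ of the banked input P4 = `KYCannotSeparatePaddedPerAllM` (module `Max/KYCannotSeparatePaddedPerAllM`, threshold
`n ≥ 2m+2`): the same LOCATED NEGATIVE with the threshold lowered to `2n ≥ 3m+2` for `m ≥ 5`. STATUS: PROVED — everything below is
kernel-checked with the standard axioms; the two arithmetic statements `KYSharper.LowKArithmetic` / `KYSharper.HighKArithmetic`
(the gen-25 stubs) are the theorems `KYSharper.lowK_criterion` (`Max/KYSharperLowK`) and `KYAllM.highK_criterion`
(`Max/KYSharperHighK`). Mathematics: theory-2 memo `calc33-allm/W1PRIME-NOTES.md` §0–§8 (NOT IN PRINT). No conjecture of the cell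
is used or asserted. HONEST FRAMING: a ceiling theorem for ONE technique class (plain Koszul–Young flattenings `Λ^p ⊗ S^k`) for
padded permanents — it moves no census row and is not a `per`-versus-`det` lower bound; occurrence obstructions are ruled out in
print (BIP'16) — multiplicity obstructions are the open door; nothing here is a claim on VP vs VNP or P vs NP.

Mathematics (memo §0–§7). Per primal cell `(p,k)`, `c = n²-1-p`, the padded side is `≤ min(S(m,k)·C(N,c+1), S(m,k+1)·C(N,c))`
(`PaddedPerKYUpperBounds`, both low-order forms; `N = n²`, `S(m,k) = Σ_{l≤k} C(m,l)²`) and the determinant side is `≥ LT(n,c,k)`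
(`DetKYLeadingTermBound`) with `n²·LT ≥ max(CHEB, TK)`: `CHEB = C(n,k+1)²·C(N,c+1)` (`SF6Smoothing.smoothing`) and the toolkit bound
`TK = C(n,k+1)·(n·C(n-1,k)·C(N,c+1) - C(n-1,k-1)·C(N,c+2))` (row-Chebyshev kept exact in the row index + Abel summation +
`n·C(i·n,c+1) ≤ G(n,c+1,i)`, `Max/KYRowMass`; `KYSharper.tkBound_le` below, `k ≥ 1`). Two-route arithmetic
`min(…)·n² ≤ max(CHEB, TK)` for `1 ≤ k ≤ 4` (`Max/KYSharperLowK`: nine manifestly-positive polynomial inequalities and a concavity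
argument in `c`; these are the only cells where the `p`-free Chebyshev criterion fails below `2m+2`) and the `p`-free criterion
`S(m,k)·n² ≤ C(n,k+1)²` for `k ≥ 5` (`Max/KYSharperHighK`: Lemma A′ for `3m ≤ 2N`); `k = 0` is trivial; dual cells by the high-order
bound + the dual leading-term count exactly as in `KYCannotSeparatePaddedPerAllM`. Exact numerics (theory-2 gen 25): the true method
threshold (all cells certified by `max(CHEB,TK)`) is `n = ⌈3m/2⌉+1` for `5 ≤ m ≤ 28`; the LT-exact threshold is `⌈3m/2⌉`
(`5 ≤ m ≤ 24`), so the toolkit loses exactly one value of `n`; for `m ≤ 4` the previous modules (`m = 3`, `n ≥ 5`; all `m`, `n ≥ 2m+2`)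
are already at least as strong.
-/

noncomputable section

namespace Summit.PneNP.GCT

open Literature.Computability.AlgebraicComplexity Literature.Barriers.ValiantsHypothesis

namespace KYSharper

open Finset DetKYLeadingTerms KYRowMass KYAllM

/-! ## The c-dependent determinant-side lower bound from the row-mass toolkit

The two shapes `KYSharper.chebBound n c k = C(n,k+1)²·C(n²,c+1)` and
`KYSharper.tkBound n c k = C(n,k+1)·(n·C(n-1,k)·C(n²,c+1) - C(n-1,k-1)·C(n²,c+2))` are defined in `Max/KYSharperLowK`. -/

/-- `CHEB ≤ n²·LT` (`SF6Smoothing.smoothing`). [folklore] -/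
theorem chebBound_le (n c k : ℕ) : chebBound n c k ≤ n ^ 2 * ltCount n c k :=
  SF6Smoothing.smoothing n c k

/-- Weighted row masses, Abel-bounded: `Σ_{i<n} C(i,j)·G(n,c,i) ≤ C(n-1,j)·C(n²,c+1)` (`1 ≤ n`). [folklore] -/
theorem weighted_rowMass_le (n c j : ℕ) (hn : 1 ≤ n) :
    ∑ i ∈ range n, i.choose j * rowMass n c i ≤ (n - 1).choose j * (n * n).choose (c + 1) := by
  rcases j with _ | j
  · simp [sum_rowMass]
  · calc ∑ i ∈ range n, i.choose (j + 1) * rowMass n c i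
        ≤ ∑ i ∈ range n, i.choose (j + 1) * rowMass n c i
            + ∑ i ∈ range (n - 1), i.choose j * ((i + 1) * n).choose (c + 1) := Nat.le_add_right _ _
      _ = (n - 1).choose (j + 1) * (n * n).choose (c + 1) := abel_rowMass_sq n c j hn

/-- The Abel correction is small: `n · Σ_{i<n-1} C(i,j)·C((i+1)·n, c+1) ≤ C(n-1,j)·C(n²,c+2)` (`1 ≤ n`). [folklore] -/
theorem corr_le (n c j : ℕ) (hn : 1 ≤ n) :
    n * ∑ i ∈ range (n - 1), i.choose j * ((i + 1) * n).choose (c + 1) ≤ (n - 1).choose j * (n * n).choose (c + 2) := by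
  calc n * ∑ i ∈ range (n - 1), i.choose j * ((i + 1) * n).choose (c + 1)
      = ∑ i ∈ range (n - 1), i.choose j * (n * ((i + 1) * n).choose (c + 1)) := by
        rw [mul_sum]; exact sum_congr rfl fun i _ => by ring
    _ ≤ ∑ i ∈ range (n - 1), (i + 1).choose j * rowMass n (c + 1) (i + 1) :=
        sum_le_sum fun i _ => Nat.mul_le_mul (Nat.choose_mono j (Nat.le_succ i)) (mul_choose_succ_le_rowMass n c i)
    _ ≤ ∑ i ∈ range n, i.choose j * rowMass n (c + 1) i := by
        have h : ∑ i ∈ range (n - 1), (i + 1).choose j * rowMass n (c + 1) (i + 1)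
            ≤ ∑ i ∈ range (n - 1 + 1), i.choose j * rowMass n (c + 1) i := by
          rw [sum_range_succ']; exact Nat.le_add_right _ _
        rwa [show n - 1 + 1 = n by omega] at h
    _ ≤ (n - 1).choose j * (n * n).choose (c + 1 + 1) := weighted_rowMass_le n (c + 1) j hn

/-- **Toolkit lower bound** (`k ≥ 1`, `n ≥ 1`): `TK(n,c,k) ≤ n²·LT(n,c,k)`. [folklore] -/
theorem tkBound_le (n c k : ℕ) (hk : 1 ≤ k) (hn : 1 ≤ n) : tkBound n c k ≤ n ^ 2 * ltCount n c k := by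
  obtain ⟨j, rfl⟩ : ∃ j, k = j + 1 := ⟨k - 1, by omega⟩
  unfold tkBound
  simp only [Nat.add_sub_cancel]
  set W := ∑ i ∈ range n, i.choose (j + 1) * rowMass n c i with hW
  set Corr := ∑ i ∈ range (n - 1), i.choose j * ((i + 1) * n).choose (c + 1) with hCorr
  have h1 : n.choose (j + 1 + 1) * W ≤ n * ltCount n c (j + 1) := choose_mul_sum_rowMass_le_ltCount' n c (j + 1)
  have habel : W + Corr = (n - 1).choose (j + 1) * (n * n).choose (c + 1) := abel_rowMass_sq n c j hn
  have hcorr : n * Corr ≤ (n - 1).choose j * (n * n).choose (c + 2) := corr_le n c j hn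
  have h2 : n * ((n - 1).choose (j + 1) * (n * n).choose (c + 1)) - (n - 1).choose j * (n * n).choose (c + 2) ≤ n * W := by
    have key : ∀ A B X T : ℕ, T = A + B → B ≤ X → T - X ≤ A := by intros; omega
    refine key (n * W) (n * Corr) _ _ ?_ hcorr
    rw [← habel]; ring
  calc n.choose (j + 1 + 1) * (n * ((n - 1).choose (j + 1) * (n * n).choose (c + 1)) - (n - 1).choose j * (n * n).choose (c + 2))
      ≤ n.choose (j + 1 + 1) * (n * W) := Nat.mul_le_mul_left _ h2
    _ = n * (n.choose (j + 1 + 1) * W) := by ring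
    _ ≤ n * (n * ltCount n c (j + 1)) := Nat.mul_le_mul_left _ h1
    _ = n ^ 2 * ltCount n c (j + 1) := by ring

/-- `max(CHEB, TK) ≤ n²·LT` (`k ≥ 1`, `n ≥ 1`). [folklore] -/
theorem max_cheb_tk_le (n c k : ℕ) (hk : 1 ≤ k) (hn : 1 ≤ n) :
    max (chebBound n c k) (tkBound n c k) ≤ n ^ 2 * ltCount n c k :=
  max_le (chebBound_le n c k) (tkBound_le n c k hk hn)

/-! ## The two arithmetic statements (PROVED in `Max/KYSharperLowK`, `Max/KYSharperHighK`) -/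

/-! ## The primal cell bound from the two arithmetic statements, and the assembly -/

/-- The low-`k` two-route arithmetic as a `Prop` (hypothesis of the assembly; proved: `lowKArithmetic_holds`). For `m ≥ 5`,
`2n ≥ 3m+2`, `1 ≤ k ≤ 4`, `2k+1 ≤ n`, `c+1 ≤ n²`: `min(S(m,k)·C(n²,c+1), S(m,k+1)·C(n²,c)) · n² ≤ max(CHEB(n,c,k), TK(n,c,k))`. [folklore] -/
def LowKArithmetic : Prop :=
  ∀ m n c k : ℕ, 5 ≤ m → 3 * m + 2 ≤ 2 * n → 1 ≤ k → k ≤ 4 → 2 * k + 1 ≤ n → c + 1 ≤ n * n →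
    min (chooseSqSum m k * (n * n).choose (c + 1)) (chooseSqSum m (k + 1) * (n * n).choose c) * n ^ 2
      ≤ max (chebBound n c k) (tkBound n c k)

/-- The high-`k` `p`-free criterion as a `Prop` (hypothesis of the assembly; proved: `highKArithmetic_holds`). For `m ≥ 5`,
`2n ≥ 3m+2`, `k ≥ 5`, `2k+1 ≤ n`: `S(m,k)·n² ≤ C(n,k+1)²`. [folklore] -/
def HighKArithmetic : Prop :=
  ∀ m n k : ℕ, 5 ≤ m → 3 * m + 2 ≤ 2 * n → 5 ≤ k → 2 * k + 1 ≤ n → chooseSqSum m k * n ^ 2 ≤ (n.choose (k + 1)) ^ 2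

/-- `LowKArithmetic` holds (`KYSharper.lowK_criterion` of `Max/KYSharperLowK`; the hypothesis `2k+1 ≤ n` is not used). [folklore] -/
theorem lowKArithmetic_holds : LowKArithmetic :=
  fun m n c k hm hn hk1 hk4 _ hc => lowK_criterion m n c k hm hn hk1 hk4 hc

/-- `HighKArithmetic` holds (`KYAllM.highK_criterion` of `Max/KYSharperHighK`; the hypothesis `5 ≤ m` is not used). [folklore] -/
theorem highKArithmetic_holds : HighKArithmetic :=
  fun m n k _ hn hk hkn => highK_criterion m n k hn hk hkn

/-- **Primal cell bound** (`m ≥ 5`, `2n ≥ 3m+2`, `2k+1 ≤ n`, `c+1 ≤ n²`):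
`min(S(m,k)·C(n²,c+1), S(m,k+1)·C(n²,c)) ≤ LT(n,c,k)`, from the two arithmetic statements. [folklore] -/
theorem primal_cell (hL : LowKArithmetic) (hH : HighKArithmetic) (m n c k : ℕ) (hm : 5 ≤ m) (hn : 3 * m + 2 ≤ 2 * n)
    (hkn : 2 * k + 1 ≤ n) (hc : c + 1 ≤ n * n) :
    min (chooseSqSum m k * (n * n).choose (c + 1)) (chooseSqSum m (k + 1) * (n * n).choose c) ≤ ltCount n c k := by
  have hn1 : 1 ≤ n := by omega
  have hn2 : 0 < n ^ 2 := by positivity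
  -- it suffices to bound `min(…)·n²` by `n²·LT`
  suffices h : min (chooseSqSum m k * (n * n).choose (c + 1)) (chooseSqSum m (k + 1) * (n * n).choose c) * n ^ 2
      ≤ n ^ 2 * ltCount n c k by
    rw [mul_comm] at h; exact Nat.le_of_mul_le_mul_left h hn2
  rcases Nat.eq_zero_or_pos k with rfl | hk1
  · -- `k = 0`: `S(m,0) = 1`, `CHEB(n,c,0) = n²·C(n²,c+1)`
    calc min (chooseSqSum m 0 * (n * n).choose (c + 1)) (chooseSqSum m (0 + 1) * (n * n).choose c) * n ^ 2
        ≤ chooseSqSum m 0 * (n * n).choose (c + 1) * n ^ 2 := Nat.mul_le_mul_right _ (min_le_left _ _)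
      _ = chebBound n c 0 := by simp [chooseSqSum, chebBound]; ring
      _ ≤ n ^ 2 * ltCount n c 0 := chebBound_le n c 0
  by_cases hk4 : k ≤ 4
  · exact (hL m n c k hm hn hk1 hk4 hkn hc).trans (max_cheb_tk_le n c k hk1 hn1)
  · have hk5 : 5 ≤ k := by omega
    calc min (chooseSqSum m k * (n * n).choose (c + 1)) (chooseSqSum m (k + 1) * (n * n).choose c) * n ^ 2
        ≤ chooseSqSum m k * (n * n).choose (c + 1) * n ^ 2 := Nat.mul_le_mul_right _ (min_le_left _ _)
      _ = chooseSqSum m k * n ^ 2 * (n * n).choose (c + 1) := by ring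
      _ ≤ (n.choose (k + 1)) ^ 2 * (n * n).choose (c + 1) := Nat.mul_le_mul_right _ (hH m n k hm hn hk5 hkn)
      _ ≤ n ^ 2 * ltCount n c k := chebBound_le n c k

/-- `KYAllM.chooseSqSum m k` is the `Finset.range` sum used by `Max/KYPaddedPermanentSide` (definitional). [folklore] -/
lemma chooseSqSum_eq (m k : ℕ) : chooseSqSum m k = ∑ i ∈ range (k + 1), (m.choose i) ^ 2 := rfl

/-- **N-F-1 at every cell for `m ≥ 5`, `n ≥ ⌈3m/2⌉+1`, from the two arithmetic statements** (assembly: primal / dual cell,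
`PaddedPerKYUpperBounds`, `primal_cell`, `DetKYLeadingTermBound`). [folklore] -/
theorem kyRank_paddedPerPoly_le_detPoly (hL : LowKArithmetic) (hH : HighKArithmetic) (m n : ℕ) [NeZero n] (hm : 5 ≤ m)
    (hn : 3 * m + 2 ≤ 2 * n) (p k : ℕ) :
    kyRank ℂ p k (paddedPerPoly ℂ m n) ≤ kyRank ℂ p k (detPoly (Fin n) ℂ) := by
  have hmn : m ≤ n := by omega
  obtain ⟨hlow, hhigh, hz⟩ := paddedPerKYUpperBounds_holds m n p k hmn
  rcases Nat.lt_or_ge k n with hk | hk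
  swap
  · rw [hz hk]; exact Nat.zero_le _
  rcases Nat.lt_or_ge p (n * n) with hp | hp
  swap
  · have h0 : (∑ i ∈ range (k + 1 + 1), (m.choose i) ^ 2) * (n * n).choose (p + 1) = 0 := by
      rw [Nat.choose_eq_zero_of_lt (by omega : n * n < p + 1), Nat.mul_zero]
    have h := hlow.trans (min_le_right _ _)
    rw [h0] at h
    exact h.trans (Nat.zero_le _)
  have hpN : p + 1 ≤ n * n := hp
  have hkn : k + 1 ≤ n := hk
  have hdetmax := detKYLeadingTermBound_holds n p k hpN hkn
  have hdet1 : ltCount n (n * n - 1 - p) k ≤ kyRank ℂ p k (detPoly (Fin n) ℂ) := (le_max_left _ _).trans hdetmax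
  have hdet2 : ltCount n p (n - 1 - k) ≤ kyRank ℂ p k (detPoly (Fin n) ℂ) := (le_max_right _ _).trans hdetmax
  by_cases hks : 2 * k + 1 ≤ n
  · -- primal cell `(p,k)`, `c = n²-1-p`: `C(N,c+1) = C(N,p)`, `C(N,c) = C(N,p+1)`
    have hc : n * n - 1 - p + 1 ≤ n * n := by omega
    have h1 : kyRank ℂ p k (paddedPerPoly ℂ m n) ≤
        min (chooseSqSum m k * (n * n).choose (n * n - 1 - p + 1)) (chooseSqSum m (k + 1) * (n * n).choose (n * n - 1 - p)) := by
      rw [show n * n - 1 - p + 1 = n * n - p by omega, Nat.choose_symm (Nat.le_of_succ_le hpN),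
        show n * n - 1 - p = n * n - (p + 1) by omega, Nat.choose_symm hpN, chooseSqSum_eq, chooseSqSum_eq]
      exact hlow
    exact h1.trans ((primal_cell hL hH m n (n * n - 1 - p) k hm hn hks hc).trans hdet1)
  · -- dual cell: `k' = n-1-k` with `2k'+1 ≤ n`, `c = p`: high-order bound `min(S(m,k'+1)·C(N,p), S(m,k')·C(N,p+1))`
    have hks' : 2 * (n - 1 - k) + 1 ≤ n := by omega
    have h1 : kyRank ℂ p k (paddedPerPoly ℂ m n) ≤
        min (chooseSqSum m (n - 1 - k) * (n * n).choose (p + 1)) (chooseSqSum m (n - 1 - k + 1) * (n * n).choose p) := by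
      rw [min_comm, show n - 1 - k + 1 = n - k by omega, chooseSqSum_eq, chooseSqSum_eq, show n - 1 - k = n - (k + 1) by omega]
      exact hhigh
    exact h1.trans ((primal_cell hL hH m n p (n - 1 - k) hm hn hks' hpN).trans hdet2)

end KYSharper

/-! ## The node (W1′) -/

/-- **N-F-1 for every `m ≥ 5` from `n = ⌈3m/2⌉+1` on (the sharper all-`m` Koszul–Young flattening ceiling, W1′; PROVED —
`kyCannotSeparatePaddedPerSharper_holds`):** for every `m ≥ 5`, every `n` with `2n ≥ 3m+2` and every `(p, k)`,
`rank KY_{p,k}(X₀₀^{n-m}·per_m) ≤ rank KY_{p,k}(det_n)` in `S^n(ℂ^{n²})` — no plain Koszul–Young flattening separates the padded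
`m × m` permanent from `det_n` once `n ≥ ⌈3m/2⌉+1`. Reduced (`kyCannotSeparatePaddedPerSharper_of`) to the two binomial inequalities
`KYSharper.LowKArithmetic`, `KYSharper.HighKArithmetic`, both proved; compare `KYCannotSeparatePaddedPerAllM` (threshold `2m+2`).
A ceiling for ONE family of equations; not a lower bound for `dc(per_m)`. [folklore] -/
def KYCannotSeparatePaddedPerSharper : Prop :=
  ∀ (m n : ℕ) [NeZero n], 5 ≤ m → 3 * m + 2 ≤ 2 * n → ∀ p k : ℕ,
    kyRank ℂ p k (paddedPerPoly ℂ m n) ≤ kyRank ℂ p k (detPoly (Fin n) ℂ)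

/-- **Reduction of W1′ to arithmetic**: the two arithmetic statements imply the sharper ceiling. [folklore] -/
theorem kyCannotSeparatePaddedPerSharper_of (hL : KYSharper.LowKArithmetic) (hH : KYSharper.HighKArithmetic) :
    KYCannotSeparatePaddedPerSharper :=
  fun m n _ hm hn p k => KYSharper.kyRank_paddedPerPoly_le_detPoly hL hH m n hm hn p k

/-- **W1′ PROVED: the sharper all-`m` Koszul–Young ceiling holds** (`m ≥ 5`, `2n ≥ 3m+2`, every `(p,k)`). [folklore] -/
theorem kyCannotSeparatePaddedPerSharper_holds : KYCannotSeparatePaddedPerSharper :=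
  kyCannotSeparatePaddedPerSharper_of KYSharper.lowKArithmetic_holds KYSharper.highKArithmetic_holds

end Summit.PneNP.GCT
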